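import Summits.Ventures.HodgeKum4.Theses.KummerFixedLocus
import Summits.Ventures.HodgeKum4.Theorems.KummerFixedLocusPointCount
import HarnessLib

/-!
# B″ glue of L3° — CONDITIONAL closer (cell `hodge-kum4`, seat p2)

HONEST FRAMING.  `(F_Γ ∧ L1) → point count → L3°` follows from seat p2's kernel chain
(`kum4NonInvariantClassesAlgebraic_glue_of_pointCount`); the eleven printed statements (nine refereed
facts of glue 19280 + the cohomological transport (T) + Oguiso's split fixed points) are REFEREED
named facts taken as hypotheses — a CONDITIONAL result; never `PolarizationHasDualLefschetz`.
-/

noncomputable section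

open Literature.AlgebraicGeometry Literature.AlgebraicGeometry.HodgeTheory
open Literature.AlgebraicGeometry.Hyperkaehler

namespace Summit.Ventures.HodgeKum4

/-- **The B″ glue, conditional on print.** -/
theorem kum4NonInvariantClassesAlgebraic_pointCountGlue_of_facts
    (hA1 : Hirzebruch1969_gSignature_involution_halfDimFixedLocus)
    (hA2 : Floccari2026_fixedFourfold_kum4Type)
    (hHIR : Voisin2002_hodgeIndex_hodgeRiemann_middle)
    (hGS : GoettscheSoergel1993_chiY_kum4Type)
    (hGK : GreenKimLazaRobles2022_llvTrivial_isOfHodgeType_kumType)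
    (hF : Foster2024_translationAction_kum4Type)
    (hcardF : Floccari2026_card_autFixingH2H3_kum4Type)
    (hFu : Fulton1998_cupPairing_transversalPoint)
    (hS1 : Andre1996_dualLefschetz_mem_adjoin_lefschetzInvolution)
    (hT : HassettTschinkel2013_Floccari2026_fixedFourfoldClass_transport_kum4Type)
    (hOg : Oguiso2020_fixedPointScheme_translation_generalizedKummerFour) :
    Summit.Ventures.HodgeKum4.Theses.KummerFixedLocus.Kum4NonInvariantClassesAlgebraicGlue2 := by
  unfold Summit.Ventures.HodgeKum4.Theses.KummerFixedLocus.Kum4NonInvariantClassesAlgebraicGlue2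
    Summit.Ventures.HodgeKum4.Theses.KummerFixedLocus.Kum4TranslationGroupAndL1
    Summit.Ventures.HodgeKum4.Theses.KummerFixedLocus.Kum4FixedPointCountAtKummer
    Summit.Ventures.HodgeKum4.Theses.KummerFixedLocus.Kum4NonInvariantClassesAlgebraic
  exact kum4NonInvariantClassesAlgebraic_glue_of_pointCount hA1 hA2 hHIR hGS hGK hF hcardF hFu hS1 hT hOg

end Summit.Ventures.HodgeKum4

end
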